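import Literature.NumberTheory.LFunctions.MauduitRivatVanDerCorputFamily
import HarnessLib

/-!
# Van der Corput for families of ℕ-indexed sequences on a box (Mauduit–Rivat 2015, Lemma 3 / (51), (54); proved)

Everything in this file is PROVED. A repackaging of `vanDerCorput_family`
(`MauduitRivatVanDerCorputFamily.lean`) for sequences indexed by `n ∈ [N₀, N₁) ⊂ ℕ`, the form in
which C. Mauduit, J. Rivat, J. Eur. Math. Soc. 17 (2015) apply their Lemma 3 in the proof of
Prop. 2 (first over `n` with dilation `1` and `R` shifts, (51); then over `m` with dilation
`q^{μ₁}` and `S` shifts, (53)–(54)), for values in a complex inner product space (C. Müllner,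
Duke Math. J. 166 (2017), §5.4):

* `vanDerCorput_family_nat` — for `x : ι → ℕ → E`, `N₀ ≤ N₁`, `1 ≤ R`, `1 ≤ q`,
  `R² ∑_i ‖∑_{N₀≤n<N₁} x_i(n)‖²
     ≤ (N₁ − N₀ + qR) · R · (∑_i ∑_n ‖x_i(n)‖² + 2 ∑_{1≤r<R} ‖∑_i ∑_{N₀≤n, n+qr<N₁} ⟪x_i(n+qr), x_i(n)⟫‖)`.

## References
* C. Mauduit, J. Rivat, J. Eur. Math. Soc. 17 (2015), Lemma 3, (51), (53)–(54). [MauduitRivat2015]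
* C. Müllner, Duke Math. J. 166 (2017), §5.4. [Mullner2017]
-/

noncomputable section

open Finset Complex
open scoped InnerProductSpace ComplexConjugate

namespace Literature.NumberTheory.LFunctions.MauduitRivat

variable {E : Type*} [NormedAddCommGroup E] [InnerProductSpace ℂ E]

/-- `[N₀, N₁) ⊂ ℕ` cast to `ℤ` is `(N₀ − 1, N₁ − 1]`. [folklore] -/
theorem map_natCast_Ico (N₀ N₁ : ℕ) :
    (Ico N₀ N₁).map Nat.castEmbedding = Ioc ((N₀ : ℤ) - 1) ((N₁ : ℤ) - 1) := by
  ext t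
  simp only [mem_map, mem_Ico, mem_Ioc, Nat.castEmbedding_apply]
  constructor
  · rintro ⟨n, ⟨h1, h2⟩, rfl⟩
    constructor <;> omega
  · rintro ⟨h1, h2⟩
    have ht : 0 ≤ t := by omega
    refine ⟨t.toNat, ⟨?_, ?_⟩, Int.toNat_of_nonneg ht⟩
    · have : (N₀ : ℤ) ≤ t := by omega
      exact (Int.le_toNat ht).2 this
    · have : t < (N₁ : ℤ) := by omega
      exact (Int.toNat_lt ht).2 this

/-- The zero extension to `ℤ` of an `ℕ`-indexed sequence restricted to `[N₀, N₁)`. [folklore] -/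
def extZ (x : ℕ → E) (N₀ N₁ : ℕ) : ℤ → E :=
  fun t => if (N₀ : ℤ) ≤ t ∧ t < N₁ then x t.toNat else 0

omit [InnerProductSpace ℂ E] in
/-- On `[N₀, N₁)` the extension agrees with `x`. [folklore] -/
theorem extZ_natCast {x : ℕ → E} {N₀ N₁ n : ℕ} (h : N₀ ≤ n ∧ n < N₁) :
    extZ x N₀ N₁ (n : ℤ) = x n := by
  unfold extZ
  rw [if_pos ⟨by exact_mod_cast h.1, by exact_mod_cast h.2⟩, Int.toNat_natCast]

omit [InnerProductSpace ℂ E] in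
/-- Off `[N₀, N₁)` the extension vanishes. [folklore] -/
theorem extZ_eq_zero {x : ℕ → E} {N₀ N₁ : ℕ} {t : ℤ} (h : ¬((N₀ : ℤ) ≤ t ∧ t < N₁)) :
    extZ x N₀ N₁ t = 0 := by
  unfold extZ; rw [if_neg h]

omit [InnerProductSpace ℂ E] in
/-- The extension is supported in `(N₀ − 1, N₁ − 1]`. [folklore] -/
theorem extZ_support (x : ℕ → E) (N₀ N₁ : ℕ) :
    ∀ t, t ∉ Ioc ((N₀ : ℤ) - 1) ((N₁ : ℤ) - 1) → extZ x N₀ N₁ t = 0 := by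
  intro t ht
  apply extZ_eq_zero
  rw [mem_Ioc] at ht
  omega

omit [InnerProductSpace ℂ E] in
/-- Sums over `(N₀ − 1, N₁ − 1]` of the extension are sums over `[N₀, N₁)`. [folklore] -/
theorem sum_Ioc_extZ {M : Type*} [AddCommMonoid M] (x : ℕ → E) (N₀ N₁ : ℕ) (g : ℤ → E → M) :
    ∑ t ∈ Ioc ((N₀ : ℤ) - 1) ((N₁ : ℤ) - 1), g t (extZ x N₀ N₁ t) =
      ∑ n ∈ Ico N₀ N₁, g n (x n) := by
  rw [← map_natCast_Ico, sum_map]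
  refine sum_congr rfl fun n hn => ?_
  rw [mem_Ico] at hn
  rw [Nat.castEmbedding_apply, extZ_natCast hn]

/-- The correlation of the extension at a shift `d ≥ 0`:
`C(d) = ∑_{N₀ ≤ n, n + d < N₁} ⟪x(n+d), x(n)⟫`. [folklore] -/
theorem corrE_extZ (x : ℕ → E) (N₀ N₁ d : ℕ) :
    corrE (extZ x N₀ N₁) ((N₀ : ℤ) - 1) ((N₁ : ℤ) - 1) (d : ℤ) =
      ∑ n ∈ (Ico N₀ N₁).filter (fun n => n + d < N₁), ⟪x (n + d), x n⟫_ℂ := by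
  rw [corrE, sum_filter]
  rw [sum_Ioc_extZ x N₀ N₁ (fun t v => ⟪extZ x N₀ N₁ (t + d), v⟫_ℂ)]
  refine sum_congr rfl fun n hn => ?_
  rw [mem_Ico] at hn
  by_cases h : n + d < N₁
  · rw [if_pos h]
    have : ((n : ℤ) + d) = ((n + d : ℕ) : ℤ) := by push_cast; ring
    rw [this, extZ_natCast ⟨by omega, h⟩]
  · rw [if_neg h, extZ_eq_zero, inner_zero_left]
    omega

/-- **Van der Corput with dilation for a family of `ℕ`-indexed sequences on `[N₀, N₁)`**
(Mauduit–Rivat's Lemma 3 as used in (51) and (54)): for `N₀ ≤ N₁`, `1 ≤ R`, `1 ≤ q`,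
`R² ∑_i ‖∑_n x_i(n)‖² ≤ (N₁ − N₀ + qR) R (∑_i ∑_n ‖x_i(n)‖² + 2 ∑_{1≤r<R} ‖∑_i ∑_{n+qr<N₁} ⟪x_i(n+qr), x_i(n)⟫‖)`.
[cite: MauduitRivat2015, Lemma 3, (51), (54)] -/
theorem vanDerCorput_family_nat {ι : Type*} (I : Finset ι) (x : ι → ℕ → E) {N₀ N₁ : ℕ}
    (hN : N₀ ≤ N₁) {R : ℕ} (hR : 1 ≤ R) {q : ℕ} (hq : 1 ≤ q) :
    (R : ℝ) ^ 2 * ∑ i ∈ I, ‖∑ n ∈ Ico N₀ N₁, x i n‖ ^ 2 ≤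
      (((N₁ - N₀ : ℕ) : ℝ) + q * R) * (R * (∑ i ∈ I, ∑ n ∈ Ico N₀ N₁, ‖x i n‖ ^ 2 +
        2 * ∑ r ∈ Ico 1 R, ‖∑ i ∈ I, ∑ n ∈ (Ico N₀ N₁).filter (fun n => n + q * r < N₁),
          ⟪x i (n + q * r), x i n⟫_ℂ‖)) := by
  have h := vanDerCorput_family I (z := fun i => extZ (x i) N₀ N₁) (a := (N₀ : ℤ) - 1)
    (b := (N₁ : ℤ) - 1) (fun i _ => extZ_support (x i) N₀ N₁) (by omega) hR
    (k := (q : ℤ)) (by exact_mod_cast hq)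
  -- identify the pieces
  have hS : ∀ i, ∑ t ∈ Ioc ((N₀ : ℤ) - 1) ((N₁ : ℤ) - 1), extZ (x i) N₀ N₁ t =
      ∑ n ∈ Ico N₀ N₁, x i n := fun i => sum_Ioc_extZ (x i) N₀ N₁ (fun _ v => v)
  have hS2 : ∀ i, ∑ t ∈ Ioc ((N₀ : ℤ) - 1) ((N₁ : ℤ) - 1), ‖extZ (x i) N₀ N₁ t‖ ^ 2 =
      ∑ n ∈ Ico N₀ N₁, ‖x i n‖ ^ 2 := fun i => sum_Ioc_extZ (x i) N₀ N₁ (fun _ v => ‖v‖ ^ 2)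
  have hC : ∀ r : ℕ, ∑ i ∈ I, corrE (extZ (x i) N₀ N₁) ((N₀ : ℤ) - 1) ((N₁ : ℤ) - 1) ((q : ℤ) * r) =
      ∑ i ∈ I, ∑ n ∈ (Ico N₀ N₁).filter (fun n => n + q * r < N₁), ⟪x i (n + q * r), x i n⟫_ℂ := by
    intro r
    refine sum_congr rfl fun i _ => ?_
    have : ((q : ℤ) * r) = ((q * r : ℕ) : ℤ) := by push_cast; ring
    rw [this, corrE_extZ]
  simp only [hS, hS2] at h
  have hsum : ∑ d ∈ Ico (1 : ℤ) R, ‖∑ i ∈ I, corrE (extZ (x i) N₀ N₁) ((N₀ : ℤ) - 1) ((N₁ : ℤ) - 1)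
      ((q : ℤ) * d)‖ = ∑ r ∈ Ico 1 R, ‖∑ i ∈ I, ∑ n ∈ (Ico N₀ N₁).filter
        (fun n => n + q * r < N₁), ⟪x i (n + q * r), x i n⟫_ℂ‖ := by
    have hmap : (Ico (1 : ℤ) R) = (Ico 1 R).map Nat.castEmbedding := by
      rw [map_natCast_Ico]
      ext t; simp only [mem_Ico, mem_Ioc]; omega
    rw [hmap, sum_map]
    refine sum_congr rfl fun r _ => ?_
    rw [Nat.castEmbedding_apply, hC r]
  rw [hsum] at h
  have hcast : (((N₁ : ℤ) - 1 : ℤ) : ℝ) - (((N₀ : ℤ) - 1 : ℤ) : ℝ) = ((N₁ - N₀ : ℕ) : ℝ) := by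
    push_cast [Nat.cast_sub hN]; ring
  have h' := h
  simp only [Int.cast_sub, Int.cast_natCast, Int.cast_one] at h'
  convert h' using 2
  push_cast [Nat.cast_sub hN]; ring

end Literature.NumberTheory.LFunctions.MauduitRivat
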